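import Summits.RiemannHypothesis.RiemannHypothesis.Theorems.CCRouteAdapters
import Literature.NumberTheory.ConnesConsani2021.ProlateEigenvaluePolynomialDecay
import Literature.NumberTheory.ConnesConsani2021.TraceRemainderEpsilon
import Literature.NumberTheory.ConnesConsani2021.EpsSlopeEnclosure
import HarnessLib

/-!
# Route «ConnesConsaniSemilocal», crux K2 `DensitySlope` (stmt-RiemannHypothesis-19308) — CLOSED, UNCONDITIONALLY

RH-FREE corpus statement, now a tree theorem with NO named-fact input (cell `rh-crit/cc`, seat `rh-crit-cc-iso` g4;
chain of record cc-lead R78/R88/R91/R93, t7 g2 08:54:18Z (ii), t15 g2 09:02:34Z).  K2 says: for every `C²` extension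
`G` of the archimedean density of Connes–Consani 2021 §5, `G′(0) = ε′(1₊)` is real and `22.9 ≤ ε′(1₊) ≤ 23.1`
(Lemma 5.4, printed `22.9965`).  Both halves are tree theorems: the ANALYTIC half `G′(0) = Σ_n t(n)` is
`CC2021_lemma_5_4_holds` (t7 g2, `ProlateEigenvaluePolynomialDecay.lean` p433298 — unconditional eigenvalue decay,
gm-t16 E9/E10 termwise calculus) and the NUMERICAL half `22.9 ≤ Σ_n t(n) ≤ 23.1` is the IN-KERNEL certificate
`SlopeCert.epsSlope_enclosure_holds` (t15 g2, `EpsSlopeEnclosure.lean` p433694: eng-1's `decide +kernel` integer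
tables, gm-t16's Bessel tail frame and Frobenius toolkit, t15's series/IVT glue; axioms standard — no floating
point, no external interval arithmetic).  They meet in t5's bridge `densitySlope_of_lemma_5_4` (whose second hypothesis is (E-b)
VERBATIM) followed by the K2 transport `CCRouteAdapters.densitySlope_iff` (seat g2) — the same term as this seat's helper
`CCRouteAdapters.densitySlope_of_epsSlopeEnclosure` (p433894) applied to `epsSlope_enclosure_holds`, inlined here.  Hence the theorem below has the route decl as its type and no
hypothesis: item stmt-RiemannHypothesis-19308 closes `proved`.
WHAT THIS IS NOT: any claim about RH — K2 is one RH-FREE binder of the route's `closes`, whose conclusion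
`WeilArchPositivity_soninTrace_fine` (CC2021 eq. (4)) is RH-FREE and not RH-detecting; the RH-EQUIVALENT residual
`IsolatedCC` is untouched.  Nothing here bears on the truth of RH.
-/

-- `Summit.RiemannHypothesis.RiemannHypothesis.…` duplicates `RiemannHypothesis` BY DESIGN (D-0017).
set_option linter.dupNamespace false

namespace Summit.RiemannHypothesis.RiemannHypothesis.Theorems.ConnesConsaniSemilocalDensitySlope

open Literature.NumberTheory.LFunctions Literature.NumberTheory.ConnesConsani2021

/-- RH-FREE. **K2 `DensitySlope` HOLDS** (route «ConnesConsaniSemilocal», item stmt-RiemannHypothesis-19308): the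
in-kernel slope enclosure `SlopeCert.epsSlope_enclosure_holds` (22.9 ≤ ε′(1₊) ≤ 23.1, t15 g2) and Lemma 5.4
(`CC2021_lemma_5_4_holds`, t7 g2) through t5's bridge `densitySlope_of_lemma_5_4` and the K2 transport
`CCRouteAdapters.densitySlope_iff` (seat g2).  The type is LITERALLY the route decl; no hypothesis.
[cite: ConnesConsani2021, Lemma 5.4 §5 p. 20 (= arXiv Lemma 31); App. G (numerical values, ε′(1₊) ≃ 22.9965)] -/
theorem densitySlope_proof :
    Summit.RiemannHypothesis.RiemannHypothesis.Theses.ConnesConsaniSemilocal.DensitySlope :=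
  CCRouteAdapters.densitySlope_iff.mpr
    (densitySlope_of_lemma_5_4 CC2021_lemma_5_4_holds SlopeCert.epsSlope_enclosure_holds)

end Summit.RiemannHypothesis.RiemannHypothesis.Theorems.ConnesConsaniSemilocalDensitySlope
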